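import Summits.Ventures.CertifiedManyBodySolver.Observables.SourcedGibbsTrialCapKSpaceRiemannDensity
import Summits.Ventures.CertifiedManyBodySolver.Observables.SourcedGibbsTrialCapKSpaceRows
import HarnessLib

/-!
# The HF–BCS sourced cap in momentum space (VII): the UNIFORM-in-`L` cap row from one certified grid `L₁`

HONEST FRAMING: zero compute; implication only. From the two-grid Davis–Rabinowitz controls
(`abs_bdgEnergyTanh_density_two_grid_le`, `abs_bdgDensity_two_grid_le`) the per-site k-space cap at ANY side
`L ≥ L₁` is bounded by data at the single grid `L₁`: energy sum shifted by `2C₁/L₁`, density confined to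
`[n₁ − 2C₂/L₁, n₁ + 2C₂/L₁]` (the quadratic `(μ'−μ)n + U n²/4` is convex for `U ≥ 0`, so its maximum on the
interval is at an endpoint), `C₁ = 2π·(3/2)(2 + 2√2|h|)`, `C₂ = 2π·β(3 + 2√2|h|)`. The remaining hypothesis `hnum`
is a numerical inequality about explicit finite sums at `L₁` (certified by the cell's two-engine interval job at
`L₁ = 4096`, `β = 10`); it is NOT proved here. Output: the Rows cell `SourcedEnergyUpperRow 0 U μ h 1 L₁ e`
(`∀ L ≥ L₁`), the shape the torus-limit / liminf floor nodes consume. A variational cap; nothing about order by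
itself; instrument statement only with a certified floor; not a superconductivity verdict.

References: Davis–Rabinowitz (1984) §2.1 (2.1.6) [DavisRabinowitz1984]; Bach–Lieb–Solovej (1994) §2
[BachLiebSolovej1994].
-/

noncomputable section

open Real Finset Literature.MathematicalPhysics.QuantumLattice Literature.Probability.LatticeModels
open Literature.MathematicalPhysics.QuantumLattice.HubbardWave0

namespace Summit.Ventures.CertifiedManyBodySolver.Observables

/-- A convex quadratic on an interval is bounded by its endpoint values: for `U ≥ 0` and `a ≤ n ≤ b`,
`c n + U n²/4 ≤ max (c a + U a²/4) (c b + U b²/4)`. [folklore] -/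
theorem quad_le_max_endpoints {U c a b n : ℝ} (hU : 0 ≤ U) (ha : a ≤ n) (hb : n ≤ b) :
    c * n + U * n ^ 2 / 4 ≤ max (c * a + U * a ^ 2 / 4) (c * b + U * b ^ 2 / 4) := by
  by_contra hcon
  rw [not_le, max_lt_iff] at hcon
  obtain ⟨h1, h2⟩ := hcon
  -- `q(n) − q(a) = (n − a)(c + U(n + a)/4) > 0` forces `n > a` and `c + U(n + a)/4 > 0`;
  -- `q(n) − q(b) = (n − b)(c + U(n + b)/4) > 0` forces `n < b` and `c + U(n + b)/4 < 0`; but `U(a − b) ≤ 0`.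
  have e1 : c * n + U * n ^ 2 / 4 - (c * a + U * a ^ 2 / 4) = (n - a) * (c + U * (n + a) / 4) := by ring
  have e2 : c * n + U * n ^ 2 / 4 - (c * b + U * b ^ 2 / 4) = (n - b) * (c + U * (n + b) / 4) := by ring
  have p1 : 0 < (n - a) * (c + U * (n + a) / 4) := by rw [← e1]; linarith
  have p2 : 0 < (n - b) * (c + U * (n + b) / 4) := by rw [← e2]; linarith
  have hc1 : 0 < c + U * (n + a) / 4 := by
    rcases lt_or_ge 0 (c + U * (n + a) / 4) with h | h
    · exact h
    · exact absurd p1 (not_lt.2 (mul_nonpos_of_nonneg_of_nonpos (sub_nonneg.2 ha) h))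
  have hc2 : c + U * (n + b) / 4 < 0 := by
    rcases lt_or_ge (c + U * (n + b) / 4) 0 with h | h
    · exact h
    · exact absurd p2 (not_lt.2 (mul_nonpos_of_nonpos_of_nonneg (sub_nonpos.2 hb) h))
  nlinarith [mul_nonneg hU (sub_nonneg.2 (ha.trans hb)), hc1, hc2]

/-- **UNIFORM-in-`L` HF–BCS cap row from one grid** (`L₁ ≥ 3`, `β ≥ 0`, `U ≥ 0`): if the `L₁`-grid data satisfy
`−(s₁ − 2C₁/L₁) − μ' + max_{±} [(μ'−μ)(n₁ ± 2C₂/L₁) + U(n₁ ± 2C₂/L₁)²/4] ≤ e`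
(`s₁ = L₁⁻²Σ_k E_k t_k`, `n₁ = L₁⁻²Σ_k(1 − ξ_k t_k/E_k)` at side `L₁`; `C₁ = 2π(3/2)(2+2√2|h|)`, `C₂ = 2πβ(3+2√2|h|)`),
then `E₀(dWaveSourceTorusTT' L 0 U μ h) ≤ e·L²` for EVERY `L ≥ L₁`, i.e. `SourcedEnergyUpperRow 0 U μ h 1 L₁ e`.
[cite: DavisRabinowitz1984, §2.1 eq. (2.1.6)] [cite: BachLiebSolovej1994, §2] -/
theorem sourcedEnergyUpperRow_of_HFBCS_kSpace_grid (L₁ : ℕ) [NeZero L₁] (hL₁ : 3 ≤ L₁) (U μ μ' h β : ℝ)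
    (hβ : 0 ≤ β) (hU : 0 ≤ U) {e : ℚ}
    (hnum : (-(((∑ k : TorusSite 2 L₁, Real.sqrt ((torusBand L₁ k - μ') ^ 2 + (2 * Real.sqrt 2 * h * dWaveGap k) ^ 2) * Real.tanh (β * Real.sqrt ((torusBand L₁ k - μ') ^ 2 + (2 * Real.sqrt 2 * h * dWaveGap k) ^ 2) / 2)) / (L₁ : ℝ) ^ 2) - (2 * (2 * π * (3 / 2 * (2 + 2 * Real.sqrt 2 * |h|))) / (L₁ : ℝ))) - μ' +
        max ((μ' - μ) * (((∑ k : TorusSite 2 L₁, (1 - (torusBand L₁ k - μ') * Real.tanh (β * Real.sqrt ((torusBand L₁ k - μ') ^ 2 + (2 * Real.sqrt 2 * h * dWaveGap k) ^ 2) / 2) / Real.sqrt ((torusBand L₁ k - μ') ^ 2 + (2 * Real.sqrt 2 * h * dWaveGap k) ^ 2))) / (L₁ : ℝ) ^ 2) - (2 * (2 * π * (β * (3 + 2 * Real.sqrt 2 * |h|))) / (L₁ : ℝ))) + U * (((∑ k : TorusSite 2 L₁, (1 - (torusBand L₁ k - μ') * Real.tanh (β * Real.sqrt ((torusBand L₁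 k - μ') ^ 2 + (2 * Real.sqrt 2 * h * dWaveGap k) ^ 2) / 2) / Real.sqrt ((torusBand L₁ k - μ') ^ 2 + (2 * Real.sqrt 2 * h * dWaveGap k) ^ 2))) / (L₁ : ℝ) ^ 2) - (2 * (2 * π * (β * (3 + 2 * Real.sqrt 2 * |h|))) / (L₁ : ℝ))) ^ 2 / 4)
            ((μ' - μ) * (((∑ k : TorusSite 2 L₁, (1 - (torusBand L₁ k - μ') * Real.tanh (β * Real.sqrt ((torusBand L₁ k - μ') ^ 2 + (2 * Real.sqrt 2 * h * dWaveGap k) ^ 2) / 2) / Real.sqrt ((torusBand L₁ k - μ') ^ 2 + (2 * Real.sqrt 2 * h * dWaveGap k) ^ 2))) / (L₁ : ℝ) ^ 2) + (2 * (2 * π * (β * (3 + 2 * Real.sqrt 2 * |h|))) / (L₁ : ℝ))) + U * (((∑ k : TorusSite 2 L₁, (1 - (torusBand L₁ k - μ') * Real.tanh (β * Real.sqrt ((torusBand L₁ k - μ') ^ 2 + (2 * Real.sqrt 2 * h * dWaveGap k) ^ 2) / 2) / Real.sqrt ((torusBand L₁ k - μ') ^ 2 + (2 * Real.sqrt 2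 * h * dWaveGap k) ^ 2))) / (L₁ : ℝ) ^ 2) + (2 * (2 * π * (β * (3 + 2 * Real.sqrt 2 * |h|))) / (L₁ : ℝ))) ^ 2 / 4)) ≤ ((e : ℚ) : ℝ)) :
    SourcedEnergyUpperRow 0 U μ h 1 L₁ e := by
  intro L _ hLL _
  have hL3 : 3 ≤ L := hL₁.trans hLL
  have hLpos : (0 : ℝ) < (L : ℝ) := Nat.cast_pos.2 (by omega)
  have hL₁pos : (0 : ℝ) < (L₁ : ℝ) := Nat.cast_pos.2 (by omega)
  have hL2 : (0 : ℝ) < (L : ℝ) ^ 2 := by positivity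
  have hLL' : (L₁ : ℝ) ≤ (L : ℝ) := by exact_mod_cast hLL
  have hinv : 1 / (L : ℝ) + 1 / (L₁ : ℝ) ≤ 2 / (L₁ : ℝ) := by
    rw [div_add_div _ _ hLpos.ne' hL₁pos.ne', div_le_div_iff₀ (by positivity) hL₁pos]
    nlinarith
  have hC1 : (0 : ℝ) ≤ (2 * π * (3 / 2 * (2 + 2 * Real.sqrt 2 * |h|))) := by positivity
  have hC2 : (0 : ℝ) ≤ (2 * π * (β * (3 + 2 * Real.sqrt 2 * |h|))) := by positivity
  -- the two-grid controls between `L` and `L₁`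
  have key2 := abs_bdgEnergyTanh_density_two_grid_le L L₁ β μ' h
  have key3 := abs_bdgDensity_two_grid_le L L₁ hβ μ' h
  refine sourcedTorusEnergyUpperRow_of_HFBCS_kSpace L hL3 U μ μ' h β ?_
  -- freeze the four momentum sums into real atoms
  generalize hA : (∑ k : TorusSite 2 L, Real.sqrt ((torusBand L k - μ') ^ 2 + (2 * Real.sqrt 2 * h * dWaveGap k) ^ 2) * Real.tanh (β * Real.sqrt ((torusBand L k - μ') ^ 2 + (2 * Real.sqrt 2 * h * dWaveGap k) ^ 2) / 2)) = A at key2 ⊢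
  generalize hB : (∑ k : TorusSite 2 L, (1 - (torusBand L k - μ') * Real.tanh (β * Real.sqrt ((torusBand L k - μ') ^ 2 + (2 * Real.sqrt 2 * h * dWaveGap k) ^ 2) / 2) / Real.sqrt ((torusBand L k - μ') ^ 2 + (2 * Real.sqrt 2 * h * dWaveGap k) ^ 2))) = B at key3 ⊢
  generalize hA₁ : (∑ k : TorusSite 2 L₁, Real.sqrt ((torusBand L₁ k - μ') ^ 2 + (2 * Real.sqrt 2 * h * dWaveGap k) ^ 2) * Real.tanh (β * Real.sqrt ((torusBand L₁ k - μ') ^ 2 + (2 * Real.sqrt 2 * h * dWaveGap k) ^ 2) / 2)) = A₁ at key2 hnum ⊢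
  generalize hB₁ : (∑ k : TorusSite 2 L₁, (1 - (torusBand L₁ k - μ') * Real.tanh (β * Real.sqrt ((torusBand L₁ k - μ') ^ 2 + (2 * Real.sqrt 2 * h * dWaveGap k) ^ 2) / 2) / Real.sqrt ((torusBand L₁ k - μ') ^ 2 + (2 * Real.sqrt 2 * h * dWaveGap k) ^ 2))) = B₁ at key3 hnum ⊢
  have hs' : |A / (L : ℝ) ^ 2 - A₁ / (L₁ : ℝ) ^ 2| ≤ 2 * (2 * π * (3 / 2 * (2 + 2 * Real.sqrt 2 * |h|))) / (L₁ : ℝ) := by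
    refine key2.trans ?_
    calc (2 * π * (3 / 2 * (2 + 2 * Real.sqrt 2 * |h|))) * (1 / (L : ℝ) + 1 / (L₁ : ℝ))
        ≤ (2 * π * (3 / 2 * (2 + 2 * Real.sqrt 2 * |h|))) * (2 / (L₁ : ℝ)) := mul_le_mul_of_nonneg_left hinv hC1
      _ = 2 * (2 * π * (3 / 2 * (2 + 2 * Real.sqrt 2 * |h|))) / (L₁ : ℝ) := by ring
  have hn' : |B / (L : ℝ) ^ 2 - B₁ / (L₁ : ℝ) ^ 2| ≤ 2 * (2 * π * (β * (3 + 2 * Real.sqrt 2 * |h|))) / (L₁ : ℝ) := by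
    refine key3.trans ?_
    calc (2 * π * (β * (3 + 2 * Real.sqrt 2 * |h|))) * (1 / (L : ℝ) + 1 / (L₁ : ℝ))
        ≤ (2 * π * (β * (3 + 2 * Real.sqrt 2 * |h|))) * (2 / (L₁ : ℝ)) := mul_le_mul_of_nonneg_left hinv hC2
      _ = 2 * (2 * π * (β * (3 + 2 * Real.sqrt 2 * |h|))) / (L₁ : ℝ) := by ring
  have hslo : A₁ / (L₁ : ℝ) ^ 2 - 2 * (2 * π * (3 / 2 * (2 + 2 * Real.sqrt 2 * |h|))) / (L₁ : ℝ) ≤ A / (L : ℝ) ^ 2 := by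
    linarith [neg_abs_le (A / (L : ℝ) ^ 2 - A₁ / (L₁ : ℝ) ^ 2)]
  have hnlo : B₁ / (L₁ : ℝ) ^ 2 - 2 * (2 * π * (β * (3 + 2 * Real.sqrt 2 * |h|))) / (L₁ : ℝ) ≤ B / (L : ℝ) ^ 2 := by
    linarith [neg_abs_le (B / (L : ℝ) ^ 2 - B₁ / (L₁ : ℝ) ^ 2)]
  have hnhi : B / (L : ℝ) ^ 2 ≤ B₁ / (L₁ : ℝ) ^ 2 + 2 * (2 * π * (β * (3 + 2 * Real.sqrt 2 * |h|))) / (L₁ : ℝ) := by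
    linarith [le_abs_self (B / (L : ℝ) ^ 2 - B₁ / (L₁ : ℝ) ^ 2)]
  -- the per-site bound at side `L`
  have hq := quad_le_max_endpoints (c := μ' - μ) hU hnlo hnhi
  have hsite : -(A / (L : ℝ) ^ 2) - μ' + ((μ' - μ) * (B / (L : ℝ) ^ 2) + U * (B / (L : ℝ) ^ 2) ^ 2 / 4) ≤
      ((e : ℚ) : ℝ) := by
    linarith [hnum, hq, hslo]
  -- undo the per-site normalisation
  have hid : (-A - μ' * (L : ℝ) ^ 2) + (μ' - μ) * B + U * ((L : ℝ) ^ 2 * (B / (2 * (L : ℝ) ^ 2)) ^ 2) =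
      (L : ℝ) ^ 2 * (-(A / (L : ℝ) ^ 2) - μ' + ((μ' - μ) * (B / (L : ℝ) ^ 2) + U * (B / (L : ℝ) ^ 2) ^ 2 / 4)) := by
    field_simp
    ring
  rw [hid]
  calc (L : ℝ) ^ 2 * (-(A / (L : ℝ) ^ 2) - μ' + ((μ' - μ) * (B / (L : ℝ) ^ 2) + U * (B / (L : ℝ) ^ 2) ^ 2 / 4))
      ≤ (L : ℝ) ^ 2 * ((e : ℚ) : ℝ) := mul_le_mul_of_nonneg_left hsite hL2.le
    _ = ((e : ℚ) : ℝ) * (L : ℝ) ^ 2 := by ring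

end Summit.Ventures.CertifiedManyBodySolver.Observables

end
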